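import Literature.Probability.LatticeModels.PlaneRotatorTwistDuality
import HarnessLib

/-!
# The helicity modulus of the plane rotator on `(ℤ/Lℤ)²` as a current–current covariance across two
# separated cuts: `βΥ_L(K) = −K²·⟨J_C · J_{C′}⟩` (`C ≠ C′`), by gauge covariance of the twist

Topic `Literature/Probability/LatticeModels`; companion of `PlaneRotatorHelicityModulus.lean` (p536677:
`twistModulus`, `torusXYStiffness = βΥ_L`), `PlaneRotatorTwistInequality.lean` (p539386) and
`PlaneRotatorTwistDuality.lean` (p542106: the current representation `Z_s(t) = ∑_n W(n) e^{itΦ_s(n)}`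
and the cut independence of the flux `torusXY_cutFlux_eq`). Everything is PROVED; the three
definitions are bookkeeping (cut profiles, the cut current).

For the nearest-neighbour plane rotator on the torus `(ℤ/Lℤ)²` at coupling `K`, let `C_j` be the
column cut (the `L` bonds `(v, e₁)` with `v₀ = j`) and `J_{C_j}(θ) = ∑_{b ∈ C_j} sin(θ_{v+e₁} − θ_v)`
its current (`cutCurrent`).

## Contents

* §1 `cutTwistProfile s̄` (twist `s̄_j` on every bond of `C_j`, none on `e₂`-bonds), `cutProfile j`,
  `cutCurrent j`.
* §2 **Gauge covariance, exactly, from the dual variables**: for a closed current `n` the flux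
  against a cut-constant profile is `(∑_j s̄_j)·w(n)` (`sum_cutTwistProfile_mul_eq`, every cut carries
  the winding number), hence `Z_s(t) = Z_{uniform}(t ∑_j s̄_j / L)`
  (`twistPartitionFn_cutTwistProfile_eq`): the twisted partition function depends on an
  `e₁`-twist profile only through its total — a boundary twist and the uniform twist field are the
  same problem (Sandvik 2010 §(spin stiffness); Fisher–Barber–Jasnow 1973 §II).
* §3 By the chain rule and uniqueness of derivatives (tree `hasDerivAt_negLog_twistPartitionFn`,
  `hasDerivAt_twistFreeEnergyDeriv_zero`): `twistModulus(K, s) = (∑_j s̄_j)²·βΥ_L(K)`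
  (`twistModulus_cutTwistProfile_eq`); in particular `Q(1_{C}) = βΥ_L`
  (`twistModulus_cutProfile_eq`) and `Q(1_C + 1_{C'}) = 4βΥ_L` (`twistModulus_cutProfile_add_eq`).
* §4 **Polarization** of the explicit second-order formula `Q(s) = ∑_b K s_b²⟨cos ∇θ_b⟩ − ⟨𝒥_s²⟩`
  for profiles with disjoint supports, `Q(s₁+s₂) = Q(s₁) + Q(s₂) − 2⟨𝒥_{s₁}𝒥_{s₂}⟩`
  (`BondSystem.twistModulus_add_of_disjoint`, any finite bond system), and the
  **CUT–CUT COVARIANCE IDENTITY** `βΥ_L(K) = −K²·⟨J_{C_j} J_{C_{j'}}⟩_K` for `j ≠ j'`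
  (`torusXYStiffness_eq_neg_sq_mul_cutCurrent_covariance`: `4βΥ_L = βΥ_L + βΥ_L − 2K²⟨J_C J_{C'}⟩`);
  `⟨J_C⟩ = 0` (`expectJ_cutCurrent_eq_zero`).
* §5 The uniform-twist fluctuation formula as the summed twin:
  `βΥ_L(K) = (K ∑_{e₁-bonds}⟨cos ∇θ_b⟩ − ⟨(K∑_{e₁-bonds} sin ∇θ_b)²⟩)/L² = K·E_L(K) − ⟨𝒥²⟩/L²`
  (`torusXYStiffness_eq_fluctuation`, `torusXYStiffness_eq_energy_sub_fluctuation`; Thijssen (15.97),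
  Sandvik's `ρ_s = (⟨H_x⟩ − β⟨I_x²⟩)/N`).

Reading (cell `pub/hubbard-tc`): the torus helicity modulus is a current–current covariance across
two SEPARATED cuts — the form in which correlation inequalities (Bricmont–Fontaine–Landau 1977 Thm A2,
Dunlop / Kunz–Pfister–Vuillermot, Lieb's criterion) bound `Υ_L` from above at high temperature; the
diagonal (`C = C'`) information is the fluctuation formula with its energy term.

## What this is not

Finite-volume identities for the classical plane rotator only; no inequality, no temperature regime,
nothing quantum or electronic; no number of the cell's tables consumes this file.

## References

* A. W. Sandvik, *Computational Studies of Quantum Spin Systems*, AIP Conf. Proc. 1297 (2010) 135,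
  arXiv:1101.3281, §(spin stiffness), pp. 26–27 (twisted boundary condition ≡ uniform twist field;
  `ρ_s = (⟨H_x⟩ − β⟨I_x²⟩)/N`, `I_x = J∑ sin(Θ_j − Θ_i)`, `⟨I_x⟩ = 0`). [Sandvik2010]
* M. E. Fisher, M. N. Barber, D. Jasnow, Phys. Rev. A 8 (1973) 1111, §II eqs. (2.3)–(2.5).
  [FisherBarberJasnow1973]
* J. M. Thijssen, *Computational Physics*, 2nd ed., CUP 2007, eq. (15.97) (after Ohta–Jasnow 1979).
  [Thijssen2007]
* J. Fröhlich, T. Spencer, Comm. Math. Phys. 83 (1982) 411, §2.3 (integer currents).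
  [FrohlichSpencerCMP1982]

Tree: `BondSystem.twistModulus(_eq)`, `twistCurrent`, `expectJ_twistCurrent_eq_zero`,
`hasDerivAt_negLog_twistPartitionFn`, `hasDerivAt_twistFreeEnergyDeriv_zero`, `torusXYStiffness`,
`coe_twistPartitionFn_eq_tsum_exp`, `torusXY_cutFlux_eq`, `torusXY_sum_dir0_eq_card_mul_cutFlux`,
`sum_torusTwistProfile_mul`, `sum_torusTwistProfile_sq_eq_card`, `torusXYBondEnergy_eq`.
Mathlib: `HasDerivAt.comp`, `HasDerivAt.unique`, `Complex.ofReal_injective`.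
-/

noncomputable section

open MeasureTheory Finset Filter Complex
open scoped BigOperators Topology

namespace Literature.Probability.LatticeModels

variable {L : ℕ} [NeZero L]

/-! ## §1 Column cuts, cut profiles, cut currents -/

/-- A twist profile supported on the `e₁`-bonds and constant on each column cut:
`s_{(v, e₁)} = s̄(v₀)`, `s_{(v, e₂)} = 0` (twist `t·s̄_j` on every bond of the cut between the columns
`j` and `j + 1`). [cite: FisherBarberJasnow1973, §II eqs. (2.3)–(2.5) (twisted boundary / distributed twist)] -/
def cutTwistProfile (sbar : ZMod L → ℝ) (b : TorusSite 2 L × Fin 2) : ℝ :=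
  if b.2 = 0 then sbar (b.1 0) else 0

/-- The indicator profile of the single cut `C_j`. [cite: FisherBarberJasnow1973, §II eqs. (2.3)–(2.5) (twisted boundary)] -/
def cutProfile (j : ZMod L) (b : TorusSite 2 L × Fin 2) : ℝ :=
  if b.2 = 0 ∧ b.1 0 = j then 1 else 0

/-- The **cut current** `J_C(θ) = ∑_{b ∈ C_j} sin(θ_{v+e₁} − θ_v)` through the column cut `C_j`.
[cite: Sandvik2010, §(spin stiffness), eq. for `I_x` (p. 27 of arXiv:1101.3281)] -/
def cutCurrent (j : ZMod L) (θ : TorusSite 2 L → Circle) : ℝ :=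
  ∑ b : TorusSite 2 L × Fin 2, cutProfile j b * imChar ((torusXY 2 L).bondChar b) θ

omit [NeZero L] in
/-- The single-cut profile is the cut-constant profile of an indicator. [folklore] -/
private theorem cutProfile_eq_cutTwistProfile (j : ZMod L) :
    cutProfile (L := L) j = cutTwistProfile (fun k => if k = j then 1 else 0) := by
  funext b
  unfold cutProfile cutTwistProfile
  by_cases h0 : b.2 = 0 <;> by_cases h1 : b.1 0 = j <;> simp [h0, h1]

omit [NeZero L] in
/-- The uniform `e₁`-twist is the cut-constant profile `s̄ ≡ 1`. [folklore] -/
private theorem torusTwistProfile_eq_cutTwistProfile :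
    torusTwistProfile L = cutTwistProfile (fun _ : ZMod L => (1 : ℝ)) := by
  funext b
  unfold torusTwistProfile cutTwistProfile
  rfl

omit [NeZero L] in
/-- Sum of two cut-constant profiles. [folklore] -/
private theorem cutTwistProfile_add (s₁ s₂ : ZMod L → ℝ) :
    cutTwistProfile (L := L) (s₁ + s₂) = cutTwistProfile s₁ + cutTwistProfile s₂ := by
  funext b
  simp only [cutTwistProfile, Pi.add_apply]
  split_ifs <;> simp

/-! ## §2 Gauge covariance from the current representation:
`Z_s(t) = Z_{uniform}(t·∑_j s̄_j / L)` -/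

/-- The flux of a closed current against a cut-constant profile: `∑_b s_b n_b = (∑_j s̄_j)·w_0(n)`
(every cut carries the same flux, tree `torusXY_cutFlux_eq`). [cite: FrohlichSpencerCMP1982, §2.3 (duality transformation: divergence-free integer currents)] -/
theorem sum_cutTwistProfile_mul_eq (sbar : ZMod L → ℝ) {n : TorusSite 2 L × Fin 2 → ℤ}
    (hn : twistChar (torusXY 2 L).bondChar 1 n = 1) :
    ∑ b : TorusSite 2 L × Fin 2, cutTwistProfile sbar b * (n b : ℝ) =
      (∑ j : ZMod L, sbar j) * ((∑ v : TorusSite 2 L, if v 0 = 0 then n (v, 0) else 0 : ℤ) : ℝ) := by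
  classical
  -- group the `e₁`-bonds by column
  have h1 : ∑ b : TorusSite 2 L × Fin 2, cutTwistProfile sbar b * (n b : ℝ) =
      ∑ v : TorusSite 2 L, sbar (v 0) * (n (v, 0) : ℝ) := by
    rw [Fintype.sum_prod_type]
    refine Finset.sum_congr rfl fun v _ => ?_
    rw [Fin.sum_univ_two]
    simp [cutTwistProfile]
  have h2 : ∑ v : TorusSite 2 L, sbar (v 0) * (n (v, 0) : ℝ) =
      ∑ j : ZMod L, sbar j * ((∑ v : TorusSite 2 L, if v 0 = j then n (v, 0) else 0 : ℤ) : ℝ) := by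
    have : ∀ j : ZMod L, sbar j * ((∑ v : TorusSite 2 L, if v 0 = j then n (v, 0) else 0 : ℤ) : ℝ) =
        ∑ v : TorusSite 2 L, if v 0 = j then sbar (v 0) * (n (v, 0) : ℝ) else 0 := fun j => by
      push_cast
      rw [Finset.mul_sum]
      refine Finset.sum_congr rfl fun v _ => ?_
      split_ifs with h
      · rw [h]
      · simp
    simp_rw [this]
    rw [Finset.sum_comm]
    refine Finset.sum_congr rfl fun v _ => ?_
    rw [Finset.sum_ite_eq, if_pos (Finset.mem_univ _)]
  rw [h1, h2, Finset.sum_mul]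
  refine Finset.sum_congr rfl fun j _ => ?_
  rw [torusXY_cutFlux_eq hn j]

/-- **Gauge covariance of the twist (exact, finite volume)**: for a twist profile supported on the
`e₁`-bonds and constant on each column cut, the twisted partition function depends only on the total
twist: `Z_s(t) = Z_{uniform}(t·∑_j s̄_j/L)`. Proof in the dual variables: `Z_s(t) = ∑_n W(n)e^{itΦ_s(n)}`
with `Φ_s(n) = (∑_j s̄_j)·w(n)` for closed `n`, and `Φ_{uniform}(n) = L·w(n)`.
[cite: Sandvik2010, §(spin stiffness) p. 26–27 of arXiv:1101.3281 (twisted boundary condition ≡ uniform twist field); FisherBarberJasnow1973 §II eqs. (2.3)–(2.5)] -/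
theorem twistPartitionFn_cutTwistProfile_eq [MeasurableSpace Circle] [BorelSpace Circle]
    (K : ℝ) (sbar : ZMod L → ℝ) (t : ℝ) :
    (torusXY 2 L).twistPartitionFn (fun _ => K) (cutTwistProfile sbar) t =
      (torusXY 2 L).twistPartitionFn (fun _ => K) (torusTwistProfile L) (t * (∑ j, sbar j) / L) := by
  classical
  have hL : (L : ℝ) ≠ 0 := Nat.cast_ne_zero.2 (NeZero.ne L)
  apply Complex.ofReal_injective
  rw [(torusXY 2 L).coe_twistPartitionFn_eq_tsum_exp, (torusXY 2 L).coe_twistPartitionFn_eq_tsum_exp]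
  refine tsum_congr fun n => ?_
  by_cases hn : twistChar (torusXY 2 L).bondChar 1 n = 1
  · have hs := sum_cutTwistProfile_mul_eq sbar hn
    have hu : ∑ b : TorusSite 2 L × Fin 2, torusTwistProfile L b * (n b : ℝ) =
        (L : ℝ) * ((∑ v : TorusSite 2 L, if v 0 = 0 then n (v, 0) else 0 : ℤ) : ℝ) := by
      rw [sum_torusTwistProfile_mul]
      have h := torusXY_sum_dir0_eq_card_mul_cutFlux hn 0
      have hcast : (∑ b ∈ Finset.univ.filter (fun b : TorusSite 2 L × Fin 2 => b.2 = 0), (n b : ℝ)) =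
          ((∑ b ∈ Finset.univ.filter (fun b : TorusSite 2 L × Fin 2 => b.2 = 0), n b : ℤ) : ℝ) := by
        push_cast; rfl
      rw [hcast, h]; push_cast; ring
    have hexp : t * ∑ b : TorusSite 2 L × Fin 2, cutTwistProfile sbar b * (n b : ℝ) =
        t * (∑ j, sbar j) / L * ∑ b : TorusSite 2 L × Fin 2, torusTwistProfile L b * (n b : ℝ) := by
      rw [hs, hu]; field_simp
    rw [if_pos hn, hexp]
  · rw [if_neg hn]; simp

/-! ## §3 The twist modulus of a cut-constant profile: `Q(s) = (∑_j s̄_j)²·βΥ_L(K)` -/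

section Modulus

variable [MeasurableSpace Circle] [BorelSpace Circle]

/-- **The twist modulus scales with the square of the total twist**: for a cut-constant `e₁`-profile,
`twistModulus(K, s) = (∑_j s̄_j)² · βΥ_L(K)` (chain rule on `−log Z_s(t) = −log Z_{uniform}(ct)`,
`c = ∑_j s̄_j / L`, with the tree's `hasDerivAt_negLog_twistPartitionFn`,
`hasDerivAt_twistFreeEnergyDeriv_zero` and uniqueness of derivatives; `βΥ_L = Q(uniform)/L²`).
[cite: FisherBarberJasnow1973, §II eqs. (2.4)–(2.5) (helicity modulus: quadratic response in the total twist)] -/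
theorem twistModulus_cutTwistProfile_eq (K : ℝ) (sbar : ZMod L → ℝ) :
    (torusXY 2 L).twistModulus (fun _ => K) (cutTwistProfile sbar) =
      (∑ j, sbar j) ^ 2 * torusXYStiffness L K := by
  set c : ℝ := (∑ j, sbar j) / L with hc
  have hL : (L : ℝ) ≠ 0 := Nat.cast_ne_zero.2 (NeZero.ne L)
  -- `Z_s(t) = Z_u(c t)`
  have hZ : ∀ t, (torusXY 2 L).twistPartitionFn (fun _ => K) (cutTwistProfile sbar) t =
      (torusXY 2 L).twistPartitionFn (fun _ => K) (torusTwistProfile L) (c * t) := fun t => by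
    rw [twistPartitionFn_cutTwistProfile_eq]; congr 1; rw [hc]; ring
  -- first derivatives: `F_s'(t) = c · F_u'(c t)`
  have hderiv : ∀ t, (torusXY 2 L).twistFreeEnergyDeriv (fun _ => K) (cutTwistProfile sbar) t =
      c * (torusXY 2 L).twistFreeEnergyDeriv (fun _ => K) (torusTwistProfile L) (c * t) := fun t => by
    have h1 := (torusXY 2 L).hasDerivAt_negLog_twistPartitionFn (fun _ => K) (cutTwistProfile sbar) t
    have h2 : HasDerivAt (fun t => -Real.log ((torusXY 2 L).twistPartitionFn (fun _ => K) (torusTwistProfile L) (c * t)))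
        ((torusXY 2 L).twistFreeEnergyDeriv (fun _ => K) (torusTwistProfile L) (c * t) * c) t := by
      have hin : HasDerivAt (fun t : ℝ => c * t) c t := by simpa using (hasDerivAt_id t).const_mul c
      exact ((torusXY 2 L).hasDerivAt_negLog_twistPartitionFn (fun _ => K) (torusTwistProfile L) (c * t)).comp t hin
    have hfun : (fun t => -Real.log ((torusXY 2 L).twistPartitionFn (fun _ => K) (cutTwistProfile sbar) t)) =
        fun t => -Real.log ((torusXY 2 L).twistPartitionFn (fun _ => K) (torusTwistProfile L) (c * t)) :=
      funext fun t => by rw [hZ t]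
    rw [hfun] at h1
    rw [h1.unique h2, mul_comm]
  -- second derivative at zero
  have h3 := (torusXY 2 L).hasDerivAt_twistFreeEnergyDeriv_zero (fun _ => K) (cutTwistProfile sbar)
  have h4 : HasDerivAt (fun t => c * (torusXY 2 L).twistFreeEnergyDeriv (fun _ => K) (torusTwistProfile L) (c * t))
      (c * ((torusXY 2 L).twistModulus (fun _ => K) (torusTwistProfile L) * c)) 0 := by
    have hin : HasDerivAt (fun t : ℝ => c * t) c 0 := by simpa using (hasDerivAt_id (0 : ℝ)).const_mul c
    have h0 := (torusXY 2 L).hasDerivAt_twistFreeEnergyDeriv_zero (fun _ => K) (torusTwistProfile L)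
    rw [show (0 : ℝ) = c * 0 by ring] at h0
    exact ((h0.comp 0 hin)).const_mul c
  have hfun2 : (torusXY 2 L).twistFreeEnergyDeriv (fun _ => K) (cutTwistProfile sbar) =
      fun t => c * (torusXY 2 L).twistFreeEnergyDeriv (fun _ => K) (torusTwistProfile L) (c * t) := funext hderiv
  rw [hfun2] at h3
  rw [h3.unique h4, torusXYStiffness, hc]
  have hcard : (Fintype.card (TorusSite 2 L) : ℝ) = (L : ℝ) ^ 2 := by
    rw [Fintype.card_fun, ZMod.card, Fintype.card_fin]; push_cast; ring
  rw [hcard]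
  field_simp

/-- In particular the single-cut twist has modulus `βΥ_L(K)`: twisting one cut is gauge-equivalent to
the uniform twist of the same total angle. [cite: Sandvik2010, §(spin stiffness) p. 26–27 of arXiv:1101.3281 (twisted boundary ≡ uniform twist)] -/
theorem twistModulus_cutProfile_eq (K : ℝ) (j : ZMod L) :
    (torusXY 2 L).twistModulus (fun _ => K) (cutProfile j) = torusXYStiffness L K := by
  classical
  rw [cutProfile_eq_cutTwistProfile, twistModulus_cutTwistProfile_eq]
  simp [Finset.sum_ite_eq']

/-- Twisting two cuts (possibly equal) by the same angle has modulus `4·βΥ_L(K)`. [cite: FisherBarberJasnow1973, §II eqs. (2.4)–(2.5) (quadratic response in the total twist)] -/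
theorem twistModulus_cutProfile_add_eq (K : ℝ) (j j' : ZMod L) :
    (torusXY 2 L).twistModulus (fun _ => K) (cutProfile j + cutProfile j') = 4 * torusXYStiffness L K := by
  classical
  rw [cutProfile_eq_cutTwistProfile, cutProfile_eq_cutTwistProfile, ← cutTwistProfile_add,
    twistModulus_cutTwistProfile_eq]
  congr 1
  simp only [Pi.add_apply, Finset.sum_add_distrib, Finset.sum_ite_eq', Finset.mem_univ, if_true]
  norm_num

end Modulus

/-! ## §4 Polarization of the twist modulus and the cut–cut covariance -/

section Covariance

variable [MeasurableSpace Circle] [BorelSpace Circle]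

omit [MeasurableSpace Circle] [BorelSpace Circle] in
/-- The twist current of a cut profile is `K` times the cut current. [folklore] -/
private theorem twistCurrent_cutProfile (K : ℝ) (j : ZMod L) (θ : TorusSite 2 L → Circle) :
    (torusXY 2 L).twistCurrent (fun _ => K) (cutProfile j) θ = K * cutCurrent j θ := by
  unfold BondSystem.twistCurrent cutCurrent
  rw [Finset.mul_sum]
  exact Finset.sum_congr rfl fun b _ => by ring

/-- **Polarization of the twist modulus**: for two profiles with disjoint supports,
`Q(s₁ + s₂) = Q(s₁) + Q(s₂) − 2⟨𝒥_{s₁} 𝒥_{s₂}⟩` (`Q = twistModulus`, `𝒥_s` the twist current; the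
energy term is additive, the current term is a square). [cite: FisherBarberJasnow1973, §II eqs. (2.4)–(2.5) (second-order twist response)] -/
theorem BondSystem.twistModulus_add_of_disjoint {V ι : Type*} [Fintype V] [Fintype ι] (G : BondSystem V ι)
    (J s₁ s₂ : ι → ℝ) (hdis : ∀ a, s₁ a * s₂ a = 0) :
    G.twistModulus J (s₁ + s₂) = G.twistModulus J s₁ + G.twistModulus J s₂ -
      2 * G.expectJ J (fun θ => G.twistCurrent J s₁ θ * G.twistCurrent J s₂ θ) := by
  have hZ := G.partitionFnJ_pos J
  have hw := G.continuous_weightJ J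
  have hc1 := G.continuous_twistCurrent J s₁
  have hc2 := G.continuous_twistCurrent J s₂
  -- the current is additive in the profile
  have hcur : ∀ θ, G.twistCurrent J (s₁ + s₂) θ = G.twistCurrent J s₁ θ + G.twistCurrent J s₂ θ := fun θ => by
    simp only [BondSystem.twistCurrent, Pi.add_apply, ← Finset.sum_add_distrib]
    exact Finset.sum_congr rfl fun a _ => by ring
  -- the energy term is additive (disjoint supports)
  have hsq : ∀ a, (s₁ + s₂) a ^ 2 = s₁ a ^ 2 + s₂ a ^ 2 := fun a => by
    simp only [Pi.add_apply]; nlinarith [hdis a]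
  rw [G.twistModulus_eq, G.twistModulus_eq, G.twistModulus_eq]
  have hE : ∑ a, J a * (s₁ + s₂) a ^ 2 * G.expectJ J (reChar (G.bondChar a)) =
      (∑ a, J a * s₁ a ^ 2 * G.expectJ J (reChar (G.bondChar a))) +
        ∑ a, J a * s₂ a ^ 2 * G.expectJ J (reChar (G.bondChar a)) := by
    rw [← Finset.sum_add_distrib]
    exact Finset.sum_congr rfl fun a _ => by rw [hsq]; ring
  -- the current term: ⟨(𝒥₁ + 𝒥₂)²⟩ = ⟨𝒥₁²⟩ + 2⟨𝒥₁𝒥₂⟩ + ⟨𝒥₂²⟩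
  have hI : G.expectJ J (fun θ => G.twistCurrent J (s₁ + s₂) θ ^ 2) =
      G.expectJ J (fun θ => G.twistCurrent J s₁ θ ^ 2) +
        2 * G.expectJ J (fun θ => G.twistCurrent J s₁ θ * G.twistCurrent J s₂ θ) +
        G.expectJ J (fun θ => G.twistCurrent J s₂ θ ^ 2) := by
    simp only [G.expectJ_eq]
    rw [mul_div_assoc', ← add_div, ← add_div]
    congr 1
    have i1 : Integrable (fun θ => G.twistCurrent J s₁ θ ^ 2 * G.weightJ J θ) (torusHaar V) :=
      integrable_torusHaar_of_continuous ((hc1.pow 2).mul hw)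
    have i2 : Integrable (fun θ => 2 * (G.twistCurrent J s₁ θ * G.twistCurrent J s₂ θ * G.weightJ J θ))
        (torusHaar V) :=
      (integrable_torusHaar_of_continuous ((hc1.mul hc2).mul hw)).const_mul 2
    have i3 : Integrable (fun θ => G.twistCurrent J s₂ θ ^ 2 * G.weightJ J θ) (torusHaar V) :=
      integrable_torusHaar_of_continuous ((hc2.pow 2).mul hw)
    have hfun : (fun θ => G.twistCurrent J (s₁ + s₂) θ ^ 2 * G.weightJ J θ) = fun θ =>
        (G.twistCurrent J s₁ θ ^ 2 * G.weightJ J θ +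
          2 * (G.twistCurrent J s₁ θ * G.twistCurrent J s₂ θ * G.weightJ J θ)) +
          G.twistCurrent J s₂ θ ^ 2 * G.weightJ J θ := funext fun θ => by rw [hcur]; ring
    have i12 : Integrable (fun θ => G.twistCurrent J s₁ θ ^ 2 * G.weightJ J θ +
        2 * (G.twistCurrent J s₁ θ * G.twistCurrent J s₂ θ * G.weightJ J θ)) (torusHaar V) := i1.add i2
    rw [hfun, integral_add i12 i3, integral_add i1 i2, integral_const_mul]
  rw [hE, hI]
  ring

/-- **The helicity modulus as a cut–cut current covariance**: for two DISTINCT column cuts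
`C_j ≠ C_{j'}` of the torus `(ℤ/Lℤ)²`,
`βΥ_L(K) = −K² · ⟨J_{C_j} · J_{C_{j'}}⟩_K`, `J_C = ∑_{b ∈ C} sin(θ_{v+e₁} − θ_v)`
(polarization `Q(1_C + 1_{C'}) − Q(1_C) − Q(1_{C'}) = −2K²⟨J_C J_{C'}⟩` with `Q(1_C) = Q(1_{C'}) = βΥ_L`,
`Q(1_C + 1_{C'}) = 4βΥ_L` by gauge covariance; `⟨J_C⟩ = 0`). The input that lets correlation
inequalities bound `Υ_L` from above at high temperature. [cite: Sandvik2010, §(spin stiffness) p. 26–27 of arXiv:1101.3281 (twisted boundary ≡ uniform twist; ρ_s = (⟨H_x⟩ − β⟨I_x²⟩)/N); FisherBarberJasnow1973 §II eqs. (2.4)–(2.5)] -/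
theorem torusXYStiffness_eq_neg_sq_mul_cutCurrent_covariance (K : ℝ) {j j' : ZMod L} (hjj : j ≠ j') :
    torusXYStiffness L K =
      -(K ^ 2 * (torusXY 2 L).expectJ (fun _ => K) (fun θ => cutCurrent j θ * cutCurrent j' θ)) := by
  classical
  have hdis : ∀ b : TorusSite 2 L × Fin 2, cutProfile j b * cutProfile j' b = 0 := fun b => by
    unfold cutProfile
    by_cases h1 : b.2 = 0 ∧ b.1 0 = j
    · have h2 : ¬ (b.2 = 0 ∧ b.1 0 = j') := fun h => hjj (h1.2.symm.trans h.2)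
      rw [if_neg h2, mul_zero]
    · rw [if_neg h1, zero_mul]
  have hpol := (torusXY 2 L).twistModulus_add_of_disjoint (fun _ => K) (cutProfile j) (cutProfile j') hdis
  rw [twistModulus_cutProfile_add_eq K j j', twistModulus_cutProfile_eq, twistModulus_cutProfile_eq] at hpol
  have hcur : (fun θ => (torusXY 2 L).twistCurrent (fun _ => K) (cutProfile j) θ *
      (torusXY 2 L).twistCurrent (fun _ => K) (cutProfile j') θ) =
      fun θ => K ^ 2 * (cutCurrent j θ * cutCurrent j' θ) := funext fun θ => by
    rw [twistCurrent_cutProfile, twistCurrent_cutProfile]; ring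
  rw [hcur] at hpol
  have hlin : (torusXY 2 L).expectJ (fun _ => K) (fun θ => K ^ 2 * (cutCurrent j θ * cutCurrent j' θ)) =
      K ^ 2 * (torusXY 2 L).expectJ (fun _ => K) (fun θ => cutCurrent j θ * cutCurrent j' θ) := by
    simp only [(torusXY 2 L).expectJ_eq]
    rw [← mul_div_assoc, ← integral_const_mul]
    congr 1
    exact integral_congr_ae (ae_of_all _ fun θ => by ring)
  rw [hlin] at hpol
  linarith

/-- The mean cut current vanishes: `⟨J_C⟩ = 0` (inversion symmetry `θ ↦ θ̄`; tree
`expectJ_twistCurrent_eq_zero`). [cite: Sandvik2010, §(spin stiffness) p. 27 of arXiv:1101.3281 (⟨I_x⟩ = 0 by symmetry)] -/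
theorem expectJ_cutCurrent_eq_zero (K : ℝ) (hK : K ≠ 0) (j : ZMod L) :
    (torusXY 2 L).expectJ (fun _ => K) (cutCurrent j) = 0 := by
  have h := (torusXY 2 L).expectJ_twistCurrent_eq_zero (fun _ => K) (cutProfile j)
  have hcur : (torusXY 2 L).twistCurrent (fun _ => K) (cutProfile j) = fun θ => K * cutCurrent j θ :=
    funext fun θ => twistCurrent_cutProfile K j θ
  rw [hcur] at h
  have hlin : (torusXY 2 L).expectJ (fun _ => K) (fun θ => K * cutCurrent j θ) =
      K * (torusXY 2 L).expectJ (fun _ => K) (cutCurrent j) := by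
    simp only [(torusXY 2 L).expectJ_eq]
    rw [← mul_div_assoc, ← integral_const_mul]
    congr 1
    exact integral_congr_ae (ae_of_all _ fun θ => by ring)
  rw [hlin] at h
  exact (mul_eq_zero.1 h).resolve_left hK

/-! ## §5 The uniform-twist fluctuation formula -/

/-- **The uniform-twist fluctuation formula** (Ohta–Jasnow / Thijssen (15.97), one direction):
`βΥ_L(K) = (K·∑_{e₁-bonds} ⟨cos ∇θ_b⟩ − ⟨(K ∑_{e₁-bonds} sin ∇θ_b)²⟩)/L²`, i.e.
`βΥ_L = K·E_L(K) − (K²/L²)⟨J_tot²⟩` with `J_tot` the total `e₁`-current — the `C = C'`-summed twin of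
the cut–cut covariance. [cite: Thijssen2007, eq. (15.97) (after Ohta–Jasnow 1979); Sandvik2010 §(spin stiffness) ρ_s = (⟨H_x⟩ − β⟨I_x²⟩)/N] -/
theorem torusXYStiffness_eq_fluctuation (K : ℝ) :
    torusXYStiffness L K =
      ((∑ b : TorusSite 2 L × Fin 2, K * torusTwistProfile L b ^ 2 *
          (torusXY 2 L).expectJ (fun _ => K) (reChar ((torusXY 2 L).bondChar b))) -
        (torusXY 2 L).expectJ (fun _ => K)
          (fun θ => (torusXY 2 L).twistCurrent (fun _ => K) (torusTwistProfile L) θ ^ 2)) /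
        (Fintype.card (TorusSite 2 L) : ℝ) := by
  rw [torusXYStiffness, (torusXY 2 L).twistModulus_eq]

/-- The same with the bond energy `E_L(K)` (all bond energies coincide on the torus):
`βΥ_L(K) = K·E_L(K) − ⟨𝒥²⟩/L²`, `𝒥 = K ∑_{e₁-bonds} sin ∇θ_b`. [cite: Thijssen2007, eq. (15.97) (after Ohta–Jasnow 1979)] -/
theorem torusXYStiffness_eq_energy_sub_fluctuation (K : ℝ) (b₀ : TorusSite 2 L × Fin 2) :
    torusXYStiffness L K = K * torusXYBondEnergy L K b₀ -
      (torusXY 2 L).expectJ (fun _ => K)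
          (fun θ => (torusXY 2 L).twistCurrent (fun _ => K) (torusTwistProfile L) θ ^ 2) /
        (Fintype.card (TorusSite 2 L) : ℝ) := by
  have hcard : (0 : ℝ) < Fintype.card (TorusSite 2 L) := Nat.cast_pos.2 Fintype.card_pos
  rw [torusXYStiffness_eq_fluctuation, sub_div]
  congr 1
  have hE : ∀ b, (torusXY 2 L).expectJ (fun _ => K) (reChar ((torusXY 2 L).bondChar b)) =
      torusXYBondEnergy L K b₀ := fun b => by
    rw [torusXY_expectJ_reChar_bondChar, torusXYBondEnergy_eq K b b₀]
  simp_rw [hE]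
  rw [show ∑ b : TorusSite 2 L × Fin 2, K * torusTwistProfile L b ^ 2 * torusXYBondEnergy L K b₀ =
      K * torusXYBondEnergy L K b₀ * ∑ b : TorusSite 2 L × Fin 2, torusTwistProfile L b ^ 2 by
    rw [Finset.mul_sum]; exact Finset.sum_congr rfl fun b _ => by ring,
    sum_torusTwistProfile_sq_eq_card, mul_div_assoc, div_self hcard.ne', mul_one]

end Covariance

end Literature.Probability.LatticeModels
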